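import Mathlib
import HarnessLib
import Summits.HubbardSuperconductivity.HubbardSuperconductivity.Theorems.WeakCouplingBCSKlCertB1gWindowD005D025
import Summits.HubbardSuperconductivity.HubbardSuperconductivity.Theorems.WeakCouplingBCSDefsKlCertB1gWinXRecord
import Summits.HubbardSuperconductivity.HubbardSuperconductivity.Theorems.WeakCouplingBCSDefsKlCertB1gWinYRecord

/-!
# Route `WeakCouplingBCS` — support item `WcbcsKohnLuttingerB1g` (stmt-HubbardSuperconductivity-0158):
# `B1g` dominance on the EXTENDED chemical-potential window `μ ∈ [-0.7275, -0.075]` (hole dopings `δ ∈ [0.05, 0.30]`)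

The window records `klCertB1gWinX` (`μ ∈ [-0.7275, -0.6875]`, 16 boxes) and `klCertB1gWinY` (`μ ∈ [-0.6875, -0.5725]`, 31 boxes) of the
cell `gate-hubbard-kl` (seat hubbard-kl-cert-2, generation 2) are adjacent to each other and to the glued window `klb1g_window_d005_d025`
(`[-0.5725, -0.075]`, records `klCertB1gWin{Z,A,B,C,D}`, 101 boxes); each record is accepted by the multiplicity-aware checker
(`decide +kernel` in its own file) and certifies, modulo its named enclosures, μ-uniform `B1g` dominance on its window (`klb1gd_window_U`).
Gluing twice more (`klb1gd_dominance_union`) gives the statement on the union: for every `μ ∈ [-0.7275, -0.075]` — an interval containing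
the free-band chemical potentials of ALL hole dopings `δ ∈ [0.05, 0.30]` (certified monotone Riemann brackets of
`δ(μ) = 1 - (2/π²)∫₀^π arccos⋆(-μ/2 - cos x) dx`: `δ(-0.7275) ∈ [0.302029, 0.302031]`, `δ(-0.075) ∈ [0.048352, 0.048354]`; the δ-reading of the
new end is `muWinD030_filling_lt : n(-0.7275) < 7/10`, `Theorems/KLProgrammeMuOfDopingWindowFillingD030Upper.lean`; write-up
HOME/hubbard-kl-cert-2/MU-WINDOW-3.md) — every `0 < U < 1` and every channel `χ ≠ B1g`:
`channelInf ε₀ μ U B1g + γ U² ≤ channelInf ε₀ μ U χ` with `γ = min γ_X (min γ_Y (min (min γ_Z γ_ABC) γ_D)) > 0`, `γ_ABC = min (min γ_A γ_B) γ_C`.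
The hypotheses are the seven named numerical statements `klCertB1gWin{X,Y,Z,A,B,C,D}.EnclosuresB1g` (148 boxes × (E1, E2, 4 × E4)
inequalities, each μ-uniform on its box), certified outside Lean by interval arithmetic in two independent implementations (gate cell
`gate-hubbard-kl`, HOME/MU-WINDOW.md, HOME/hubbard-kl-cert-2/MU-WINDOW-2.md and MU-WINDOW-3.md).
-/

noncomputable section

-- the tree's namespace `Summit.<Summit>.<Problem>.Theorems` repeats the summit name by design (D-0017)
set_option linter.dupNamespace false

namespace Summit.HubbardSuperconductivity.HubbardSuperconductivity.Theorems

open Literature.MathematicalPhysics.QuantumLattice CwKLChiralWindow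
open Summit.HubbardSuperconductivity.HubbardSuperconductivity.Theses.WeakCouplingBCS

/-- **`B1g` (`d_{x²-y²}`) dominance of the second-order Kohn–Luttinger vertex on the extended window `μ ∈ [-0.7275, -0.075]`**
(⊃ `μ([0.05, 0.30])`), modulo the certified enclosures of the seven window records: for every such `μ`, every `0 < U < 1` and every
`χ ≠ B1g`, `channelInf ε₀ μ U B1g + γ·U² ≤ channelInf ε₀ μ U χ` with `γ = min γ_X (min γ_Y (min (min γ_Z γ_ABC) γ_D))`, the record margins.
[cite: RaghuKivelsonScalapino2010, §III Fig. 2] -/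
theorem klb1g_window_d005_d030 (hX : klCertB1gWinX.EnclosuresB1g) (hY : klCertB1gWinY.EnclosuresB1g)
    (hZ : klCertB1gWinZ.EnclosuresB1g) (hA : klCertB1gWinA.EnclosuresB1g) (hB : klCertB1gWinB.EnclosuresB1g)
    (hC : klCertB1gWinC.EnclosuresB1g) (hD : klCertB1gWinD.EnclosuresB1g) :
    ∀ μ ∈ Set.Icc (-0.7275 : ℝ) (-0.075), ∀ U ∈ Set.Ioo (0 : ℝ) 1, ∀ χ : D4Irrep, χ ≠ D4Irrep.B1g →
      channelInf (squareDispersion 1 0) μ U D4Irrep.B1g +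
          min ((klCertB1gWinX.gamma : ℚ) : ℝ)
            (min ((klCertB1gWinY.gamma : ℚ) : ℝ)
              (min (min ((klCertB1gWinZ.gamma : ℚ) : ℝ)
                (min (min ((klCertB1gWinA.gamma : ℚ) : ℝ) ((klCertB1gWinB.gamma : ℚ) : ℝ)) ((klCertB1gWinC.gamma : ℚ) : ℝ)))
                ((klCertB1gWinD.gamma : ℚ) : ℝ))) * U ^ 2 ≤
        channelInf (squareDispersion 1 0) μ U χ := by
  have hXw := klCertB1gWinX_window_U hX
  have hYw := klCertB1gWinY_window_U hY
  have hM := klb1g_window_d005_d025 hZ hA hB hC hD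
  have hloX : (((klCertB1gWinX).mub : ℚ) : ℝ) = -0.7275 := by
    show (((-291 : ℚ) / 400 : ℚ) : ℝ) = -0.7275
    norm_num
  have hhiX : (((klCertB1gWinX).mua : ℚ) : ℝ) = -0.6875 := by
    show (((-11 : ℚ) / 16 : ℚ) : ℝ) = -0.6875
    norm_num
  have hloY : (((klCertB1gWinY).mub : ℚ) : ℝ) = -0.6875 := by
    show (((-11 : ℚ) / 16 : ℚ) : ℝ) = -0.6875
    norm_num
  have hhiY : (((klCertB1gWinY).mua : ℚ) : ℝ) = -0.5725 := by
    show (((-229 : ℚ) / 400 : ℚ) : ℝ) = -0.5725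
    norm_num
  rw [hloX, hhiX] at hXw
  rw [hloY, hhiY] at hYw
  have h1 := klb1gd_dominance_union (a₁ := (-0.6875 : ℝ)) (b₁ := (-0.5725 : ℝ)) (a₂ := (-0.5725 : ℝ)) (b₂ := (-0.075 : ℝ))
    le_rfl hYw hM
  exact klb1gd_dominance_union (a₁ := (-0.7275 : ℝ)) (b₁ := (-0.6875 : ℝ)) (a₂ := (-0.6875 : ℝ)) (b₂ := (-0.075 : ℝ))
    le_rfl hXw h1

/-- The extended-window margin is positive: `γ = min γ_X (min γ_Y (min (min γ_Z γ_ABC) γ_D)) > 0` (kernel decision on the seven record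
rationals). [folklore] -/
theorem klb1g_window_d005_d030_gamma_pos :
    0 < min klCertB1gWinX.gamma
      (min klCertB1gWinY.gamma
        (min (min klCertB1gWinZ.gamma (min (min klCertB1gWinA.gamma klCertB1gWinB.gamma) klCertB1gWinC.gamma))
          klCertB1gWinD.gamma)) := by
  decide +kernel

/-- The numerical value of the extended-window margin: `γ = γ_Y = 14349/1048576 ≈ 0.013684` (the right part of `klCertB1gWinY`,
box `[-0.6475, -0.6425]` at `N = 160`, `E` binding). [folklore] -/
theorem klb1g_window_d005_d030_gamma_eq :
    min klCertB1gWinX.gamma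
      (min klCertB1gWinY.gamma
        (min (min klCertB1gWinZ.gamma (min (min klCertB1gWinA.gamma klCertB1gWinB.gamma) klCertB1gWinC.gamma))
          klCertB1gWinD.gamma)) = 14349 / 1048576 := by
  decide +kernel

end Summit.HubbardSuperconductivity.HubbardSuperconductivity.Theorems

end
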